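import Literature.AlgebraicGeometry.Resolution.LogChartSharpReduction
import HarnessLib

/-!
# Crux `FrobeniusLadder.FRationalResolution` (stmt-ResolutionOfSingularities-15317), line `redirect`,
# stub `stub_diagonalizableQuotientResolution` — **the base chart is a chart algebra over itself**
# (surface case; lets the FIRST round of blow-up charts `A[I/φ(a)]` enter the chart-algebra formalism of
# `…ChartAlgebraNormalForm` … `…VertexChartBlowupCharts` through `…ChartAlgebraTower` /
# `…VertexChartBlowupCharts.tower_pack` with `(C, Q, χ) := (A, P, φ)`)

For a chart `φ : P → A`: the identity data `(A, P, φ)` satisfy (χ) `self_chi`, (gen) `self_adjoin_eq_top`,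
(D) `self_denominators`, (K) `self_kernel`, (Ω) `self_fieldExtension`; and the unit-face group
`ℤF_𝔭 ⊆ ℤⁿ` is finitely generated (`span_faceMonoid_fg`, the hypothesis `L.FG` of `…VertexChartFG`).
Honest label: bookkeeping toward ONE leaf stub (no stub, crux or summit closed). No definitions, no named
facts, no sorry. [cite: Kato1994, Def. (2.1)]
-/

-- single-problem summit: the doubled namespace component is forced
set_option linter.dupNamespace false

open Literature.AlgebraicGeometry.Resolution Literature.AlgebraicGeometry.Resolution.LogChart

namespace Summit.ResolutionOfSingularities.ResolutionOfSingularities.Theorems.FRationalResolution.BaseChartAlgebra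

universe u

variable {A : Type u} [CommRing A] {n : ℕ} {P : AddSubmonoid (Fin n → ℤ)} {φ : Multiplicative P →* A}

/-- (χ) for the identity: `φ(p) = algebraMap A A (φ p)`. [folklore] -/
theorem self_chi : ∀ p : P, φ (Multiplicative.ofAdd ⟨(p : Fin n → ℤ), (le_refl P) p.2⟩) =
    algebraMap A A (φ (Multiplicative.ofAdd p)) :=
  fun _ => rfl

/-- (gen) for the identity: `A` is generated over itself by anything. [folklore] -/
theorem self_adjoin_eq_top : Algebra.adjoin A (Set.range (φ : Multiplicative P → A)) = ⊤ :=
  eq_top_iff.2 fun a _ => Subalgebra.algebraMap_mem _ a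

/-- (D) for the identity chart: `q + 0 ∈ P`. [folklore] -/
theorem self_denominators : ∀ q ∈ P, ∃ p ∈ P, q + p ∈ P :=
  fun q hq => ⟨0, P.zero_mem, by rwa [add_zero]⟩

/-- (K) for the identity: the kernel of `A → A` is trivial. [folklore] -/
theorem self_kernel : ∀ a : A, algebraMap A A a = 0 → ∃ p : P, φ (Multiplicative.ofAdd p) * a = 0 :=
  fun a ha => ⟨0, by rw [ofAdd_zero, map_one, one_mul]; exact ha⟩

/-- (Ω) for the identity: ring maps out of `A` extend to `A`. [folklore] -/
theorem self_fieldExtension : ∀ (K : Type u) [Field K] (g : A →+* K),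
    (∀ p : P, g (φ (Multiplicative.ofAdd p)) ≠ 0) → ∃ ω : A →+* K, ω.comp (algebraMap A A) = g :=
  fun _ _ g _ => ⟨g, RingHom.ext fun _ => rfl⟩

/-- The unit-face group `ℤF_𝔭 ⊆ ℤⁿ` is finitely generated (a subgroup of `ℤⁿ`). [folklore] -/
theorem span_faceMonoid_fg (𝔭 : Ideal A) [𝔭.IsPrime] :
    (Submodule.span ℤ (faceMonoid P φ 𝔭 : Set (Fin n → ℤ))).FG :=
  Submodule.FG.of_finite

end Summit.ResolutionOfSingularities.ResolutionOfSingularities.Theorems.FRationalResolution.BaseChartAlgebra
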